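import Summits.AtomisticToContinuum.BoseEinsteinCondensation.Theses.BECDispersionLadder
import Summits.AtomisticToContinuum.BoseEinsteinCondensation.Theorems.BECDispersionLadderEndpointTransferOccupationFourier
import Literature.MathematicalPhysics.QuantumManyBody.PeriodicMaxFormBound
import HarnessLib

/-!
# Route `BECDispersionLadder`, support item `EndpointTransfer` (stmt-AtomisticToContinuum-14557), IIa:
# momentum truncation on `L²((ℝ/ℤ)^{3N})` — coefficients, tail, symmetry, dispersion ratio, bounded weights

Helper file (supports, does not close, stmt-AtomisticToContinuum-14557): the elementary tools of the
momentum truncation `g = ∑_{ν ∈ F_R} ⟪e_ν, f⟫ e_ν` of a class `f ∈ L²((ℝ/ℤ)^{3N})` to the box `F_R = {|ν_{i,k}| ≤ R}`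
used by part IIb (`…EnergyContinuity.lean`):

* `inner_mFourierLp_sum_smul`, `ofReal_norm_sub_trunc_sq`, `mul_tsum_tail_le` — coefficients of the truncation, the
  squared distance as the tail sum, tail versus weighted sum;
* `inner_symm_trunc` — the truncation of a Bose-symmetric class is Bose-symmetric;
* `le_sum_fracDispersion_of_not_mem_lowFreq` (`2π(R+1)/L ≤ ∑ᵢ|2πνᵢ/L|^α` off the box, `α ≥ 1`, `L ≤ 2π(R+1)`) and
  `sum_fracDispersion_two_le_mul` (`∑ᵢ|2πνᵢ/L|² ≤ max(1,(6πR/L)^{2-α}) ∑ᵢ|2πνᵢ/L|^α` on the box);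
* `lintegral_weight_sq_le_add` — for a bounded measurable weight `W ≤ M` and `L²` classes `f, g`:
  `∫ W|g|² ≤ ∫ W|f|² + M(‖g-f‖² + 2‖g-f‖‖f‖)` (Cauchy–Schwarz).

References: B. Simon, *J. Operator Theory* 1 (1979) 37–47 (form cores); [ReedSimonIV1978] Thm XIII.64.
-/

noncomputable section

open MeasureTheory Filter UnitAddTorus Complex
open scoped ENNReal NNReal BigOperators Topology InnerProductSpace ComplexConjugate

namespace Summit.AtomisticToContinuum.BoseEinsteinCondensation.Theorems

open Literature.MathematicalPhysics.QuantumManyBody.BoseGas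
open Summit.AtomisticToContinuum.BoseEinsteinCondensation.Cruxes.StaticResponseBound.UvThomsonForceWave

-- The measure on `ℝ/ℤ` is the Haar PROBABILITY measure, as in `PeriodicFormDomain.lean`.
attribute [local instance] Literature.MathematicalPhysics.QuantumManyBody.BoseGas.formDomain_measureSpace
  Literature.MathematicalPhysics.QuantumManyBody.BoseGas.formDomain_isProbabilityMeasure
  Literature.MathematicalPhysics.QuantumManyBody.BoseGas.formDomain_isProbabilityMeasure_pi

namespace EndpointTransfer

variable {N : ℕ} {L : ℝ}

/-! ### Truncation in momentum space: coefficients, tail, symmetry -/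

/-- The Fourier coefficients of a finite Fourier sum: `⟪e_μ, ∑_{ν ∈ F} c_ν e_ν⟫ = c_μ 1_{μ ∈ F}`. [folklore] -/
theorem inner_mFourierLp_sum_smul (F : Finset (Fin N × Fin 3 → ℤ)) (c : (Fin N × Fin 3 → ℤ) → ℂ)
    (μ : Fin N × Fin 3 → ℤ) :
    ⟪(mFourierLp 2 μ : Lp ℂ 2 (volume : Measure (UnitAddTorus (Fin N × Fin 3)))),
      ∑ ν ∈ F, c ν • (mFourierLp 2 ν : Lp ℂ 2 (volume : Measure (UnitAddTorus (Fin N × Fin 3))))⟫_ℂ =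
      if μ ∈ F then c μ else 0 := by
  classical
  have horth : Orthonormal ℂ (fun ν : Fin N × Fin 3 → ℤ =>
      (mFourierLp 2 ν : Lp ℂ 2 (volume : Measure (UnitAddTorus (Fin N × Fin 3))))) := by
    have h := (mFourierBasis (d := Fin N × Fin 3)).orthonormal
    rwa [coe_mFourierBasis] at h
  rw [inner_sum]
  simp_rw [inner_smul_right, orthonormal_iff_ite.1 horth, mul_ite, mul_one, mul_zero]
  exact Finset.sum_ite_eq F μ c

/-- **The squared distance to the truncation is the tail sum** (`ℝ≥0∞` form):
`‖f - ∑_{ν ∈ F} ⟪e_ν, f⟫ e_ν‖² = ∑_{ν ∉ F} |⟪e_ν, f⟫|²`. [folklore] -/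
theorem ofReal_norm_sub_trunc_sq (f : Lp ℂ 2 (volume : Measure (UnitAddTorus (Fin N × Fin 3))))
    (F : Finset (Fin N × Fin 3 → ℤ)) :
    ENNReal.ofReal (‖f - ∑ ν ∈ F, ⟪(mFourierLp 2 ν : Lp ℂ 2 (volume : Measure (UnitAddTorus (Fin N × Fin 3)))), f⟫_ℂ •
        (mFourierLp 2 ν : Lp ℂ 2 (volume : Measure (UnitAddTorus (Fin N × Fin 3))))‖ ^ 2) =
      ∑' ν : Fin N × Fin 3 → ℤ, if ν ∈ F then 0 else
        (‖⟪(mFourierLp 2 ν : Lp ℂ 2 (volume : Measure (UnitAddTorus (Fin N × Fin 3)))), f⟫_ℂ‖₊ : ℝ≥0∞) ^ 2 := by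
  classical
  have h := hasSum_norm_sub_sum_inner_smul_sq (mFourierBasis (d := Fin N × Fin 3)) F f
  rw [coe_mFourierBasis] at h
  rw [← h.tsum_eq, ENNReal.ofReal_tsum_of_nonneg (fun ν => by positivity) h.summable]
  refine tsum_congr fun ν => ?_
  split_ifs
  · simp
  · rw [coe_nnnorm_sq_eq_ofReal]

/-- Termwise comparison of a tail sum with a weighted sum: if `a ≤ D_ν` off `F`, then
`a ∑_{ν ∉ F} x_ν ≤ ∑_ν D_ν x_ν`. [folklore] -/
theorem mul_tsum_tail_le {ι : Type*} [DecidableEq ι] (F : Finset ι) {a : ℝ≥0∞} {D : ι → ℝ≥0∞}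
    (hD : ∀ ν, ν ∉ F → a ≤ D ν) (x : ι → ℝ≥0∞) :
    a * ∑' ν, (if ν ∈ F then 0 else x ν) ≤ ∑' ν, D ν * x ν := by
  rw [← ENNReal.tsum_mul_left]
  refine ENNReal.tsum_le_tsum fun ν => ?_
  split_ifs with hν
  · simp
  · exact mul_le_mul_left (hD ν hν) _

/-- Membership in the low-frequency box is invariant under the particle permutations of the momenta.
[folklore] -/
theorem comp_perm_mem_lowFreq_iff (σ : Equiv.Perm (Fin N)) (R : ℕ) (ν : Fin N × Fin 3 → ℤ) :
    (fun q : Fin N × Fin 3 => ν (σ q.1, q.2)) ∈ lowFreq N R ↔ ν ∈ lowFreq N R := by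
  simp only [lowFreq, Fintype.mem_piFinset]
  constructor
  · intro h q
    simpa using h (σ.symm q.1, q.2)
  · intro h q
    exact h _

/-- **The momentum truncation of a Bose-symmetric class is Bose-symmetric.** [folklore] -/
theorem inner_symm_trunc (f : Lp ℂ 2 (volume : Measure (UnitAddTorus (Fin N × Fin 3))))
    (hsymm : ∀ (σ : Equiv.Perm (Fin N)) (n : Fin N × Fin 3 → ℤ),
      ⟪(mFourierLp 2 (fun p : Fin N × Fin 3 => n (σ p.1, p.2)) : Lp ℂ 2 (volume : Measure (UnitAddTorus (Fin N × Fin 3)))), f⟫_ℂ =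
        ⟪(mFourierLp 2 n : Lp ℂ 2 (volume : Measure (UnitAddTorus (Fin N × Fin 3)))), f⟫_ℂ)
    (R : ℕ) (σ : Equiv.Perm (Fin N)) (n : Fin N × Fin 3 → ℤ) :
    ⟪(mFourierLp 2 (fun p : Fin N × Fin 3 => n (σ p.1, p.2)) : Lp ℂ 2 (volume : Measure (UnitAddTorus (Fin N × Fin 3)))),
        ∑ ν ∈ lowFreq N R, ⟪(mFourierLp 2 ν : Lp ℂ 2 (volume : Measure (UnitAddTorus (Fin N × Fin 3)))), f⟫_ℂ •
          (mFourierLp 2 ν : Lp ℂ 2 (volume : Measure (UnitAddTorus (Fin N × Fin 3))))⟫_ℂ =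
      ⟪(mFourierLp 2 n : Lp ℂ 2 (volume : Measure (UnitAddTorus (Fin N × Fin 3)))),
        ∑ ν ∈ lowFreq N R, ⟪(mFourierLp 2 ν : Lp ℂ 2 (volume : Measure (UnitAddTorus (Fin N × Fin 3)))), f⟫_ℂ •
          (mFourierLp 2 ν : Lp ℂ 2 (volume : Measure (UnitAddTorus (Fin N × Fin 3))))⟫_ℂ := by
  rw [inner_mFourierLp_sum_smul, inner_mFourierLp_sum_smul]
  by_cases hn : n ∈ lowFreq N R
  · rw [if_pos hn, if_pos ((comp_perm_mem_lowFreq_iff σ R n).2 hn), hsymm]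
  · rw [if_neg hn, if_neg (mt (comp_perm_mem_lowFreq_iff σ R n).1 hn)]

/-! ### The dispersion: lower bound off the box, ratio on the box -/

/-- **Off the low-frequency box the `α`-dispersion is large**: for `1 ≤ α`, `L ≤ 2π(R+1)` and `ν ∉ F_R`,
`2π(R+1)/L ≤ ∑ᵢ |2πνᵢ/L|^α`. [folklore] -/
theorem le_sum_fracDispersion_of_not_mem_lowFreq (hL : 0 < L) {α : ℝ} (hα : 1 ≤ α) {R : ℕ}
    (hR : L ≤ 2 * Real.pi * (R + 1)) {ν : Fin N × Fin 3 → ℤ} (hν : ν ∉ lowFreq N R) :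
    ENNReal.ofReal (2 * Real.pi * (R + 1) / L) ≤ ∑ i : Fin N, fracDispersion α L (fun k => ν (i, k)) := by
  simp only [lowFreq, Fintype.mem_piFinset, Finset.mem_Icc, not_forall, not_and_or, not_le] at hν
  obtain ⟨q, hq⟩ := hν
  have hq' : (R : ℝ) + 1 ≤ |((ν q : ℤ) : ℝ)| := by
    have h1 : (R : ℤ) + 1 ≤ |ν q| := by
      rcases hq with h | h
      · rw [abs_of_neg (by omega)]; omega
      · rw [abs_of_pos (by omega)]; omega
    exact_mod_cast h1
  -- the single particle `q.1` already carries the bound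
  refine le_trans ?_ (Finset.single_le_sum (f := fun i => fracDispersion α L (fun k => ν (i, k)))
    (fun i _ => bot_le) (Finset.mem_univ q.1))
  unfold fracDispersion
  set t : ℝ := 2 * Real.pi / L * Real.sqrt (∑ k : Fin 3, (((ν (q.1, k)) : ℤ) : ℝ) ^ 2) with ht
  have hsqrt : (R : ℝ) + 1 ≤ Real.sqrt (∑ k : Fin 3, (((ν (q.1, k)) : ℤ) : ℝ) ^ 2) := by
    refine Real.le_sqrt_of_sq_le ?_
    calc ((R : ℝ) + 1) ^ 2 ≤ |((ν q : ℤ) : ℝ)| ^ 2 := pow_le_pow_left₀ (by positivity) hq' 2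
      _ = (((ν (q.1, q.2)) : ℤ) : ℝ) ^ 2 := by rw [sq_abs]
      _ ≤ ∑ k : Fin 3, (((ν (q.1, k)) : ℤ) : ℝ) ^ 2 :=
          Finset.single_le_sum (f := fun k => (((ν (q.1, k)) : ℤ) : ℝ) ^ 2) (fun k _ => sq_nonneg _)
            (Finset.mem_univ q.2)
  have hbase : 2 * Real.pi * (R + 1) / L ≤ t := by
    calc 2 * Real.pi * (R + 1) / L = 2 * Real.pi / L * (R + 1) := by ring
      _ ≤ t := by rw [ht]; gcongr
  have h1t : 1 ≤ t := le_trans (by rw [le_div_iff₀ hL]; linarith) hbase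
  refine ENNReal.ofReal_le_ofReal (hbase.trans ?_)
  calc t = t ^ (1 : ℝ) := (Real.rpow_one t).symm
    _ ≤ t ^ α := Real.rpow_le_rpow_of_exponent_le h1t hα

/-- **On the low-frequency box the endpoint dispersion is controlled by the `α`-dispersion**:
for `α ≤ 2`, `|p_k| ≤ R` (all `k`), `|2πp/L|² ≤ max(1, (6πR/L)^{2-α}) |2πp/L|^α`. [folklore] -/
theorem fracDispersion_two_le_mul (hL : 0 < L) {α : ℝ} (hα2 : α ≤ 2) {R : ℕ} {p : Fin 3 → ℤ}
    (hp : ∀ k, |p k| ≤ R) :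
    fracDispersion 2 L p ≤
      ENNReal.ofReal (max 1 ((2 * Real.pi / L * (3 * R)) ^ (2 - α))) * fracDispersion α L p := by
  unfold fracDispersion
  set t : ℝ := 2 * Real.pi / L * Real.sqrt (∑ k : Fin 3, ((p k : ℤ) : ℝ) ^ 2) with ht
  set T : ℝ := 2 * Real.pi / L * (3 * R) with hT
  have ht0 : 0 ≤ t := by positivity
  have htT : t ≤ T := by
    rw [ht, hT]
    gcongr
    refine Real.sqrt_le_iff.2 ⟨by positivity, ?_⟩
    have hk : ∀ k, ((p k : ℤ) : ℝ) ^ 2 ≤ (R : ℝ) ^ 2 := fun k => by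
      have h1 : |((p k : ℤ) : ℝ)| ≤ R := by exact_mod_cast hp k
      calc ((p k : ℤ) : ℝ) ^ 2 = |((p k : ℤ) : ℝ)| ^ 2 := (sq_abs _).symm
        _ ≤ (R : ℝ) ^ 2 := pow_le_pow_left₀ (abs_nonneg _) h1 2
    calc ∑ k : Fin 3, ((p k : ℤ) : ℝ) ^ 2 ≤ ∑ _k : Fin 3, (R : ℝ) ^ 2 := Finset.sum_le_sum fun k _ => hk k
      _ = 3 * (R : ℝ) ^ 2 := by simp
      _ ≤ (3 * (R : ℝ)) ^ 2 := by nlinarith [sq_nonneg (R : ℝ)]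
  rw [← ENNReal.ofReal_mul (le_trans zero_le_one (le_max_left _ _))]
  refine ENNReal.ofReal_le_ofReal ?_
  rcases eq_or_lt_of_le ht0 with h0 | htpos
  · rw [← h0, Real.zero_rpow two_ne_zero]
    exact mul_nonneg (le_trans zero_le_one (le_max_left _ _)) (Real.rpow_nonneg le_rfl _)
  rcases le_total t 1 with h1 | h1
  · calc t ^ (2 : ℝ) ≤ t ^ α := Real.rpow_le_rpow_of_exponent_ge htpos h1 hα2
      _ = 1 * t ^ α := (one_mul _).symm
      _ ≤ max 1 (T ^ (2 - α)) * t ^ α :=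
          mul_le_mul_of_nonneg_right (le_max_left _ _) (Real.rpow_nonneg ht0 α)
  · calc t ^ (2 : ℝ) = t ^ (2 - α) * t ^ α := by
          rw [← Real.rpow_add htpos, sub_add_cancel]
      _ ≤ T ^ (2 - α) * t ^ α :=
          mul_le_mul_of_nonneg_right (Real.rpow_le_rpow ht0 htT (by linarith)) (Real.rpow_nonneg ht0 α)
      _ ≤ max 1 (T ^ (2 - α)) * t ^ α :=
          mul_le_mul_of_nonneg_right (le_max_right _ _) (Real.rpow_nonneg ht0 α)

/-- The symmetrised form on the box: for `ν ∈ F_R`,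
`∑ᵢ |2πνᵢ/L|² ≤ max(1, (6πR/L)^{2-α}) ∑ᵢ |2πνᵢ/L|^α`. [folklore] -/
theorem sum_fracDispersion_two_le_mul (hL : 0 < L) {α : ℝ} (hα2 : α ≤ 2) {R : ℕ} {ν : Fin N × Fin 3 → ℤ}
    (hν : ν ∈ lowFreq N R) :
    ∑ i : Fin N, fracDispersion 2 L (fun k => ν (i, k)) ≤
      ENNReal.ofReal (max 1 ((2 * Real.pi / L * (3 * R)) ^ (2 - α))) *
        ∑ i : Fin N, fracDispersion α L (fun k => ν (i, k)) := by
  rw [Finset.mul_sum]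
  refine Finset.sum_le_sum fun i _ => fracDispersion_two_le_mul hL hα2 fun k => ?_
  simp only [lowFreq, Fintype.mem_piFinset, Finset.mem_Icc] at hν
  exact abs_le.2 (hν (i, k))

/-! ### A bounded weight under an `L²` perturbation -/

/-- `(∫ ‖x‖₊²)^{1/2} = ‖x‖` in `ℝ≥0∞` for an `L²` class. [folklore] -/
theorem lintegral_nnnorm_sq_rpow_half (x : Lp ℂ 2 (volume : Measure (UnitAddTorus (Fin N × Fin 3)))) :
    (∫⁻ t, ((‖(x : UnitAddTorus (Fin N × Fin 3) → ℂ) t‖₊ : ℝ≥0∞)) ^ (2 : ℝ)) ^ (1 / (2 : ℝ)) = ENNReal.ofReal ‖x‖ := by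
  simp only [ENNReal.rpow_two]
  rw [← ENNReal.ofReal_toReal (norm_Lp_two_sq_eq_toReal x).2, ← (norm_Lp_two_sq_eq_toReal x).1,
    ENNReal.ofReal_rpow_of_nonneg (by positivity) (by positivity), ← Real.sqrt_eq_rpow,
    Real.sqrt_sq (norm_nonneg _)]

/-- **A bounded weight under an `L²` perturbation**: for `W ≤ M` and `L²` classes `f, g`,
`∫ W|g|² ≤ ∫ W|f|² + M(‖g - f‖² + 2‖g - f‖‖f‖)` (pointwise `|g|² ≤ |f|² + |g-f|² + 2|g-f||f|`, then
Cauchy–Schwarz). [folklore] -/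
theorem lintegral_weight_sq_le_add {W : UnitAddTorus (Fin N × Fin 3) → ℝ≥0∞} (hWm : Measurable W) {M : ℝ≥0∞}
    (hW : ∀ t, W t ≤ M) (f g : Lp ℂ 2 (volume : Measure (UnitAddTorus (Fin N × Fin 3)))) :
    ∫⁻ t, W t * (‖(g : UnitAddTorus (Fin N × Fin 3) → ℂ) t‖₊ : ℝ≥0∞) ^ 2 ≤
      (∫⁻ t, W t * (‖(f : UnitAddTorus (Fin N × Fin 3) → ℂ) t‖₊ : ℝ≥0∞) ^ 2) +
        M * ENNReal.ofReal (‖g - f‖ ^ 2 + 2 * (‖g - f‖ * ‖f‖)) := by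
  set h : Lp ℂ 2 (volume : Measure (UnitAddTorus (Fin N × Fin 3))) := g - f with hh
  have hmeas : ∀ x : Lp ℂ 2 (volume : Measure (UnitAddTorus (Fin N × Fin 3))),
      AEMeasurable (fun t => ((‖(x : UnitAddTorus (Fin N × Fin 3) → ℂ) t‖₊ : ℝ≥0∞))) volume := fun x =>
    (Lp.aestronglyMeasurable x).aemeasurable.nnnorm.coe_nnreal_ennreal
  -- pointwise: `‖g‖₊² ≤ ‖f‖₊² + (‖h‖₊² + 2‖h‖₊‖f‖₊)` a.e.
  have hpt : ∀ᵐ t ∂(volume : Measure (UnitAddTorus (Fin N × Fin 3))),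
      W t * (‖(g : UnitAddTorus (Fin N × Fin 3) → ℂ) t‖₊ : ℝ≥0∞) ^ 2 ≤
        W t * (‖(f : UnitAddTorus (Fin N × Fin 3) → ℂ) t‖₊ : ℝ≥0∞) ^ 2 +
          M * (((‖(h : UnitAddTorus (Fin N × Fin 3) → ℂ) t‖₊ : ℝ≥0∞)) ^ 2 +
            2 * (((‖(h : UnitAddTorus (Fin N × Fin 3) → ℂ) t‖₊ : ℝ≥0∞)) *
              ((‖(f : UnitAddTorus (Fin N × Fin 3) → ℂ) t‖₊ : ℝ≥0∞)))) := by
    filter_upwards [Lp.coeFn_sub g f] with t ht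
    have hgt : (g : UnitAddTorus (Fin N × Fin 3) → ℂ) t =
        (f : UnitAddTorus (Fin N × Fin 3) → ℂ) t + (h : UnitAddTorus (Fin N × Fin 3) → ℂ) t := by
      rw [hh, ht, Pi.sub_apply]; ring
    have hle : ((‖(g : UnitAddTorus (Fin N × Fin 3) → ℂ) t‖₊ : ℝ≥0∞)) ≤
        ((‖(f : UnitAddTorus (Fin N × Fin 3) → ℂ) t‖₊ : ℝ≥0∞)) + ((‖(h : UnitAddTorus (Fin N × Fin 3) → ℂ) t‖₊ : ℝ≥0∞)) := by
      rw [hgt]; exact_mod_cast nnnorm_add_le _ _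
    calc W t * (‖(g : UnitAddTorus (Fin N × Fin 3) → ℂ) t‖₊ : ℝ≥0∞) ^ 2
        ≤ W t * (((‖(f : UnitAddTorus (Fin N × Fin 3) → ℂ) t‖₊ : ℝ≥0∞)) +
            ((‖(h : UnitAddTorus (Fin N × Fin 3) → ℂ) t‖₊ : ℝ≥0∞))) ^ 2 := by gcongr
      _ = W t * (‖(f : UnitAddTorus (Fin N × Fin 3) → ℂ) t‖₊ : ℝ≥0∞) ^ 2 +
          W t * (((‖(h : UnitAddTorus (Fin N × Fin 3) → ℂ) t‖₊ : ℝ≥0∞)) ^ 2 +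
            2 * (((‖(h : UnitAddTorus (Fin N × Fin 3) → ℂ) t‖₊ : ℝ≥0∞)) *
              ((‖(f : UnitAddTorus (Fin N × Fin 3) → ℂ) t‖₊ : ℝ≥0∞)))) := by ring
      _ ≤ _ := by gcongr; exact hW t
  -- integrate
  refine (lintegral_mono_ae hpt).trans ?_
  have hm1 : AEMeasurable (fun t => W t * ((‖(f : UnitAddTorus (Fin N × Fin 3) → ℂ) t‖₊ : ℝ≥0∞)) ^ 2) volume :=
    hWm.aemeasurable.mul ((hmeas f).pow_const 2)
  have hm3 : AEMeasurable (fun t => ((‖(h : UnitAddTorus (Fin N × Fin 3) → ℂ) t‖₊ : ℝ≥0∞)) *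
      ((‖(f : UnitAddTorus (Fin N × Fin 3) → ℂ) t‖₊ : ℝ≥0∞))) volume := (hmeas h).mul (hmeas f)
  have hm4 : AEMeasurable (fun t => ((‖(h : UnitAddTorus (Fin N × Fin 3) → ℂ) t‖₊ : ℝ≥0∞)) ^ 2) volume :=
    (hmeas h).pow_const 2
  have hm2 : AEMeasurable (fun t => ((‖(h : UnitAddTorus (Fin N × Fin 3) → ℂ) t‖₊ : ℝ≥0∞)) ^ 2 +
      2 * (((‖(h : UnitAddTorus (Fin N × Fin 3) → ℂ) t‖₊ : ℝ≥0∞)) *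
        ((‖(f : UnitAddTorus (Fin N × Fin 3) → ℂ) t‖₊ : ℝ≥0∞)))) volume := hm4.add (hm3.const_mul 2)
  have e1 : ∫⁻ t, W t * (‖(f : UnitAddTorus (Fin N × Fin 3) → ℂ) t‖₊ : ℝ≥0∞) ^ 2 +
      M * (((‖(h : UnitAddTorus (Fin N × Fin 3) → ℂ) t‖₊ : ℝ≥0∞)) ^ 2 +
        2 * (((‖(h : UnitAddTorus (Fin N × Fin 3) → ℂ) t‖₊ : ℝ≥0∞)) *
          ((‖(f : UnitAddTorus (Fin N × Fin 3) → ℂ) t‖₊ : ℝ≥0∞)))) =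
      (∫⁻ t, W t * (‖(f : UnitAddTorus (Fin N × Fin 3) → ℂ) t‖₊ : ℝ≥0∞) ^ 2) +
        M * ((∫⁻ t, ((‖(h : UnitAddTorus (Fin N × Fin 3) → ℂ) t‖₊ : ℝ≥0∞)) ^ 2) +
          2 * ∫⁻ t, ((‖(h : UnitAddTorus (Fin N × Fin 3) → ℂ) t‖₊ : ℝ≥0∞)) *
            ((‖(f : UnitAddTorus (Fin N × Fin 3) → ℂ) t‖₊ : ℝ≥0∞))) := by
    have e2 : ∫⁻ t, ((‖(h : UnitAddTorus (Fin N × Fin 3) → ℂ) t‖₊ : ℝ≥0∞)) ^ 2 +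
        2 * (((‖(h : UnitAddTorus (Fin N × Fin 3) → ℂ) t‖₊ : ℝ≥0∞)) *
          ((‖(f : UnitAddTorus (Fin N × Fin 3) → ℂ) t‖₊ : ℝ≥0∞))) =
        (∫⁻ t, ((‖(h : UnitAddTorus (Fin N × Fin 3) → ℂ) t‖₊ : ℝ≥0∞)) ^ 2) +
          2 * ∫⁻ t, ((‖(h : UnitAddTorus (Fin N × Fin 3) → ℂ) t‖₊ : ℝ≥0∞)) *
            ((‖(f : UnitAddTorus (Fin N × Fin 3) → ℂ) t‖₊ : ℝ≥0∞)) := by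
      have e3 := lintegral_add_left' (μ := (volume : Measure (UnitAddTorus (Fin N × Fin 3)))) hm4
        (fun t => 2 * (((‖(h : UnitAddTorus (Fin N × Fin 3) → ℂ) t‖₊ : ℝ≥0∞)) *
          ((‖(f : UnitAddTorus (Fin N × Fin 3) → ℂ) t‖₊ : ℝ≥0∞))))
      have e4 := lintegral_const_mul'' (μ := (volume : Measure (UnitAddTorus (Fin N × Fin 3)))) 2 hm3
      exact e3.trans (by rw [e4])
    have e5 := lintegral_add_left' (μ := (volume : Measure (UnitAddTorus (Fin N × Fin 3)))) hm1
      (fun t => M * (((‖(h : UnitAddTorus (Fin N × Fin 3) → ℂ) t‖₊ : ℝ≥0∞)) ^ 2 +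
        2 * (((‖(h : UnitAddTorus (Fin N × Fin 3) → ℂ) t‖₊ : ℝ≥0∞)) *
          ((‖(f : UnitAddTorus (Fin N × Fin 3) → ℂ) t‖₊ : ℝ≥0∞)))))
    have e6 := lintegral_const_mul'' (μ := (volume : Measure (UnitAddTorus (Fin N × Fin 3)))) M hm2
    exact e5.trans (by rw [e6, e2])
  rw [e1]
  gcongr
  -- `∫ ‖h‖₊² = ‖h‖²` and Cauchy–Schwarz `∫ ‖h‖₊‖f‖₊ ≤ ‖h‖ ‖f‖`
  have h1 : ∫⁻ t, ((‖(h : UnitAddTorus (Fin N × Fin 3) → ℂ) t‖₊ : ℝ≥0∞)) ^ 2 = ENNReal.ofReal (‖h‖ ^ 2) := by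
    rw [(norm_Lp_two_sq_eq_toReal h).1, ENNReal.ofReal_toReal (norm_Lp_two_sq_eq_toReal h).2]
  have h2 : ∫⁻ t, ((‖(h : UnitAddTorus (Fin N × Fin 3) → ℂ) t‖₊ : ℝ≥0∞)) *
      ((‖(f : UnitAddTorus (Fin N × Fin 3) → ℂ) t‖₊ : ℝ≥0∞)) ≤ ENNReal.ofReal (‖h‖ * ‖f‖) := by
    have hcs := ENNReal.lintegral_mul_le_Lp_mul_Lq volume Real.HolderConjugate.two_two (hmeas h) (hmeas f)
    rw [lintegral_nnnorm_sq_rpow_half, lintegral_nnnorm_sq_rpow_half,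
      ← ENNReal.ofReal_mul (norm_nonneg _)] at hcs
    exact hcs
  calc _ ≤ ENNReal.ofReal (‖h‖ ^ 2) + 2 * ENNReal.ofReal (‖h‖ * ‖f‖) := by rw [h1]; gcongr
    _ = ENNReal.ofReal (‖h‖ ^ 2 + 2 * (‖h‖ * ‖f‖)) := by
        rw [ENNReal.ofReal_add (by positivity) (by positivity), ENNReal.ofReal_mul zero_le_two,
          ENNReal.ofReal_ofNat]


end EndpointTransfer

end Summit.AtomisticToContinuum.BoseEinsteinCondensation.Theorems

end
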